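import Summits.RiemannHypothesis.RiemannHypothesis.Theorems.MotivicDoorDecreeAtoms
import HarnessLib

/-!
# The decreed distribution `N` at `u = 1`: its Hadamard finite part is `½(γ + log 2π)`

Connes–Consani motivic door, cc-3 gen 18 (RH-free: no zeros of `ζ`, no positivity; Bombieri's
explicit formula only through the killed Lévy–Khintchine form `two_mul_ccN_toMul_eq_markov`).
Framing: lottery ticket at the motivic door; RH probability negligible; consolation prizes are
real: a new semi-local Weil-positivity theorem, or a located gap in the Connes–Consani programme,
plus the ff-door theorem.  VERDICT (standing): `Nonempty ArithmeticWeilSurface` is a restatement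
of RH in structure clothing, not a different-looking hypothesis.

PRINTED (Connes, Essay, arXiv:1509.05576): p. 14 l. 26–27 "as `N(1)` represents the Euler
characteristic one should expect that `N(1) = −∞`"; p. 14 l. 46–52: the archimedean part of `N`
is the distribution `κ(u)` of the explicit formula, `∫₁^∞ κ(u)f(u)d*u = ∫₁^∞ (u²f(u) − f(1))/
(u² − 1) d*u + c f(1)`, `c = ½(log π + γ)` (this is `ccN`, Connes–Consani arXiv:1805.10501
§3.1); p. 15 l. 38–44 "`N` is finite as a distribution, but when one looks at it as a function
its value at `q = 1` is formally … `−∞`".  Gen 16/17 (`MotivicDoorDecreeContinuity`,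
`…OrderOne`, `…Atoms`) settled `N` OFF the point `u = 1` (tests with `κ(0) = 0`): a positive
measure, atoms `Λ(n) n^{-1/2}` at `log n`, density `w(t) = e^{t/2}/(2 sinh t) = 1/(2t) + O(1)`
of infinite mass at `0⁺`, order exactly one.  This file settles the POINT `u = 1` (`t = 0`).

PROVED (additive side, `N = ccN` on `toMul κ`, `κ` a real Weil test, `w = weilArchDensity`):
* `ccN_toMul_eq_cutoff` (exact, every `δ > 0`): `N(toMul κ) = c(δ) κ(0)
    + Σ_{log n < 2a} Λ(n) n^{-1/2} κ(log n) + ∫_δ^∞ w κ − ∫₀^δ w (κ(0) − κ)`,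
  `c(δ) = M_a/2 − Σ_{log n<2a} Λ(n) n^{-1/2} − ∫_δ^∞ w` (`M_a = weilMarkovConstant a`);
* `finitePartCoeff_eq`, `abs_finitePartRem_le`: `c(δ) = ½(γ + log 2π) + ½ log δ + r(δ)`,
  `|r(δ)| ≤ ¾ δ` on `(0, 2]` — the killing integral `∫₀^∞ (e^{t/2} − 1) dt/(2 sinh t)` of `M_a`
  CANCELS against the tail of `w` (`w − (e^{t/2} − 1)/(2 sinh t) = 1/(2 sinh t)`,
  `∫_δ^∞ dt/(2 sinh t) = −½ log tanh(δ/2)`), so no closed form of it is needed;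
* `abs_ccN_toMul_sub_finitePart_le`: `|N(toMul κ) − [(½(γ + log 2π) + ½ log δ) κ(0) + Σ … +
  ∫_δ^∞ w κ]| ≤ (¾|κ(0)| + M₁) δ` for `0 < δ ≤ 1`, `M₁` a Lipschitz constant of `κ` at `0`;
* `tendsto_ccN_toMul_finitePart` (**Hadamard finite part**): for EVERY real Weil test,
  `N(toMul κ) = lim_{δ→0⁺} [ Σ_n Λ(n) toMul κ(n) + ∫_δ^∞ w κ − ½ log(1/δ) κ(0) ]
    + ½(γ + log 2π) κ(0)`:
  `N = (prime atoms) + Pf.(w dt) + ½(γ + log 2π) δ₀`; the constant is Connes's `c` of p. 14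
  plus `½ log 2` (`= ∫₀^∞ dt/(eᵗ + 1) = log 2` of `two_mul_ccN_toMul` minus the finite part
  `½ log 2` of `∫_δ^∞ dt/(2 sinh t) = ½ log(2/δ) + o(1)`);
  `finitePart_unique`: no other constant works (for `κ(0) ≠ 0`);
* `ccN_toMul_le_finitePart`, `exists_ccN_toMul_le_half_log` (**`N(1) = −∞` literally**): for a
  test with `κ ≤ κ(0)` on `(0, ε]`, `κ(0) ≥ 0`, vanishing on `[ε, ∞)`, `ε ≤ ½`:
  `N(toMul κ) ≤ (½ log ε + ½(γ + log 2π) + ¾ε) κ(0)`; normalised bumps of width `ε → 0` at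
  `u = 1` have `N → −∞` at the rate `½ log ε` — the compensation of the infinite mass of `w`.
NOT CLAIMED: Connes's `N(1) ∼ −½ E log E` (p. 15 l. 41–42) is a statement through the zeros and
is not touched here; nothing in this file bears on RH.
-/

noncomputable section

set_option linter.dupNamespace false

open Complex Set MeasureTheory Filter Topology Literature.NumberTheory.LFunctions
open Literature.NumberTheory.ConnesConsani2019
open Summit.RiemannHypothesis.RiemannHypothesis.Theorems.MotivicDoor.ArchLogLaplacian
open scoped Real ComplexConjugate ArithmeticFunction.vonMangoldt

namespace Summit.RiemannHypothesis.RiemannHypothesis.Theorems.MotivicDoor.ConnesConsani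

variable {κ : ℝ → ℝ}

/-! ## 1. The density against the killing density: `w − (e^{t/2} − 1)/(2 sinh t) = 1/(2 sinh t)` -/

/-- `w(t) = (e^{t/2} − 1)/(2 sinh t) + 1/(2 sinh t)`.  PROVED (algebra). -/
theorem weilArchDensity_eq_killing_add_inv (t : ℝ) :
    weilArchDensity t = (Real.exp (t / 2) - 1) / (2 * Real.sinh t) + 1 / (2 * Real.sinh t) := by
  unfold weilArchDensity
  ring

/-- The killing density is at most `½` on `(0, 2]` (`e^{t/2} − 1 ≤ t ≤ sinh t`).  PROVED. -/
theorem weilKillingDensity_le_half {t : ℝ} (ht : 0 < t) (ht2 : t ≤ 2) :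
    (Real.exp (t / 2) - 1) / (2 * Real.sinh t) ≤ 1 / 2 := by
  have hs : 0 < Real.sinh t := Real.sinh_pos_iff.2 ht
  have hst : t ≤ Real.sinh t := Real.self_le_sinh_iff.2 ht.le
  have he : Real.exp (t / 2) - 1 ≤ t := by
    have h := Real.abs_exp_sub_one_le (x := t / 2) (by rw [abs_of_pos (half_pos ht)]; linarith)
    rw [abs_of_pos (half_pos ht)] at h
    linarith [(abs_le.1 h).2]
  rw [div_le_div_iff₀ (mul_pos two_pos hs) two_pos]
  linarith

/-- **The tail of `w` through the killing integral**: for `δ > 0`,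
`∫_δ^∞ w = ∫₀^∞ (e^{t/2} − 1)/(2 sinh t) − ∫₀^δ (e^{t/2} − 1)/(2 sinh t) − ½ log tanh(δ/2)`.
PROVED (`integral_Ioi_inv_two_sinh`). -/
theorem integral_Ioi_weilArchDensity_eq_killing {δ : ℝ} (hδ : 0 < δ) :
    ∫ t in Ioi δ, weilArchDensity t =
      (∫ t in Ioi (0 : ℝ), (Real.exp (t / 2) - 1) / (2 * Real.sinh t)) -
        (∫ t in Ioc 0 δ, (Real.exp (t / 2) - 1) / (2 * Real.sinh t)) -
        1 / 2 * (Real.log (Real.sinh (δ / 2)) - Real.log (Real.cosh (δ / 2))) := by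
  have hj := integrableOn_weilKillingDensity
  have hsplit : ∫ t in Ioi (0 : ℝ), (Real.exp (t / 2) - 1) / (2 * Real.sinh t) =
      (∫ t in Ioc 0 δ, (Real.exp (t / 2) - 1) / (2 * Real.sinh t)) +
        ∫ t in Ioi δ, (Real.exp (t / 2) - 1) / (2 * Real.sinh t) := by
    rw [← Ioc_union_Ioi_eq_Ioi hδ.le, setIntegral_union (Set.Ioc_disjoint_Ioi le_rfl)
      measurableSet_Ioi (hj.mono_set Ioc_subset_Ioi_self) (hj.mono_set (Ioi_subset_Ioi hδ.le))]
  obtain ⟨hi, hv⟩ := integral_Ioi_inv_two_sinh (half_pos hδ)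
  rw [show 2 * (δ / 2) = δ by ring] at hi hv
  have hw : ∫ t in Ioi δ, weilArchDensity t =
      (∫ t in Ioi δ, (Real.exp (t / 2) - 1) / (2 * Real.sinh t)) +
        ∫ t in Ioi δ, 1 / (2 * Real.sinh t) := by
    rw [← integral_add (hj.mono_set (Ioi_subset_Ioi hδ.le)) hi]
    exact setIntegral_congr_fun measurableSet_Ioi fun t _ ↦ weilArchDensity_eq_killing_add_inv t
  rw [hw, hv, hsplit]
  ring

/-! ## 2. The coefficient of `κ(0)`: `½(γ + log 2π) + ½ log δ + O(δ)` -/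

/-- **The cutoff coefficient.**  For every window `a` and `δ > 0`,
`M_a/2 − Σ_{log n < 2a} Λ(n) n^{-1/2} − ∫_δ^∞ w = ½(γ + log 2π) + ½ log δ + r(δ)`,
`r(δ) = ∫₀^δ (e^{t/2} − 1) dt/(2 sinh t) + ½ (log tanh(δ/2) − log(δ/2))`: the killing
integral of `M_a` cancels.  PROVED. -/
theorem finitePartCoeff_eq (a : ℝ) {δ : ℝ} (hδ : 0 < δ) :
    weilMarkovConstant a / 2 - (∑ n ∈ weilPrimeIndex a, (Λ n : ℝ) / Real.sqrt n) -
        ∫ t in Ioi δ, weilArchDensity t =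
      (Real.eulerMascheroniConstant + Real.log (2 * π)) / 2 + Real.log δ / 2 +
        ((∫ t in Ioc 0 δ, (Real.exp (t / 2) - 1) / (2 * Real.sinh t)) +
          1 / 2 * (Real.log (Real.sinh (δ / 2)) - Real.log (Real.cosh (δ / 2)) -
            Real.log (δ / 2))) := by
  rw [integral_Ioi_weilArchDensity_eq_killing hδ, weilMarkovConstant]
  have h4 : Real.log (4 * π) = 2 * Real.log 2 + Real.log π := by
    rw [Real.log_mul (by norm_num) Real.pi_pos.ne', show (4 : ℝ) = 2 ^ 2 by norm_num,
      Real.log_pow]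
    push_cast
    ring
  have h2π : Real.log (2 * π) = Real.log 2 + Real.log π :=
    Real.log_mul two_ne_zero Real.pi_pos.ne'
  have hδ2 : Real.log (δ / 2) = Real.log δ - Real.log 2 := Real.log_div hδ.ne' two_ne_zero
  rw [h4, h2π, hδ2]
  ring

/-- **The remainder is `O(δ)`**: `|r(δ)| ≤ ¾ δ` for `0 < δ ≤ 2` (`0 ≤` killing density `≤ ½`,
`|log tanh(δ/2) − log(δ/2)| ≤ δ/2`).  PROVED. -/
theorem abs_finitePartRem_le {δ : ℝ} (hδ : 0 < δ) (hδ2 : δ ≤ 2) :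
    |(∫ t in Ioc 0 δ, (Real.exp (t / 2) - 1) / (2 * Real.sinh t)) +
        1 / 2 * (Real.log (Real.sinh (δ / 2)) - Real.log (Real.cosh (δ / 2)) -
          Real.log (δ / 2))| ≤ 3 / 4 * δ := by
  have hJ0 : 0 ≤ ∫ t in Ioc 0 δ, (Real.exp (t / 2) - 1) / (2 * Real.sinh t) :=
    setIntegral_nonneg measurableSet_Ioc fun t ht ↦ weilKillingDensity_nonneg ht.1
  have hJ1 : (∫ t in Ioc 0 δ, (Real.exp (t / 2) - 1) / (2 * Real.sinh t)) ≤ 1 / 2 * δ := by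
    have h := norm_setIntegral_le_of_norm_le_const (μ := volume)
      (f := fun t ↦ (Real.exp (t / 2) - 1) / (2 * Real.sinh t)) (s := Ioc (0 : ℝ) δ)
      (C := 1 / 2) (by simp) fun t ht ↦ by
        rw [Real.norm_of_nonneg (weilKillingDensity_nonneg ht.1)]
        exact weilKillingDensity_le_half ht.1 (ht.2.trans hδ2)
    rw [Real.norm_eq_abs, Real.volume_real_Ioc_of_le hδ.le, sub_zero] at h
    exact (le_abs_self _).trans h
  have hT := abs_neg_log_tanh_sub_log_inv_le (half_pos hδ) (by linarith : δ / 2 ≤ 1)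
  rw [one_div, Real.log_inv] at hT
  obtain ⟨hT1, hT2⟩ := abs_le.1 hT
  rw [abs_le]
  constructor <;> linarith

/-! ## 3. The exact cutoff identity -/

/-- **Hadamard cutoff of `N` at length `δ`.**  For a real Weil test `κ` vanishing on `[2a, ∞)`
and every `δ > 0`:
`N(toMul κ) = c(δ) κ(0) + Σ_{log n<2a} Λ(n) n^{-1/2} κ(log n) + ∫_δ^∞ w κ − ∫₀^δ w (κ(0) − κ)`,
`c(δ) = M_a/2 − Σ_{log n<2a} Λ(n) n^{-1/2} − ∫_δ^∞ w`.  PROVED. -/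
theorem ccN_toMul_eq_cutoff (hκ : IsWeilTest fun t ↦ (κ t : ℂ)) {a : ℝ}
    (hκa : ∀ t, 2 * a ≤ t → κ t = 0) {δ : ℝ} (hδ : 0 < δ) :
    ccN (toMul κ) =
      (weilMarkovConstant a / 2 - (∑ n ∈ weilPrimeIndex a, (Λ n : ℝ) / Real.sqrt n) -
            ∫ t in Ioi δ, weilArchDensity t) * κ 0 +
          (∑ n ∈ weilPrimeIndex a, (Λ n : ℝ) / Real.sqrt n * κ (Real.log n)) +
          (∫ t in Ioi δ, weilArchDensity t * κ t) -
        ∫ t in Ioc 0 δ, weilArchDensity t * (κ 0 - κ t) := by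
  have h := two_mul_ccN_toMul_eq_markov hκ hκa
  have hint : IntegrableOn (fun t ↦ weilArchDensity t * (κ 0 - κ t)) (Ioi 0) := by
    refine IntegrableOn.congr_fun (integrableOn_weilArchDensity_mul_sub hκ).neg (fun t _ ↦ ?_)
      measurableSet_Ioi
    simp only [Pi.neg_apply]
    ring
  have hsplit : ∫ t in Ioi (0 : ℝ), weilArchDensity t * (κ 0 - κ t) =
      (∫ t in Ioc (0 : ℝ) δ, weilArchDensity t * (κ 0 - κ t)) +
        ∫ t in Ioi δ, weilArchDensity t * (κ 0 - κ t) := by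
    rw [← Ioc_union_Ioi_eq_Ioi hδ.le, setIntegral_union (Set.Ioc_disjoint_Ioi le_rfl)
      measurableSet_Ioi (hint.mono_set Ioc_subset_Ioi_self)
      (hint.mono_set (Ioi_subset_Ioi hδ.le))]
  have hw := integrableOn_weilArchDensity_Ioi hδ
  have hwκ : IntegrableOn (fun t ↦ weilArchDensity t * κ t) (Ioi δ) := by
    refine IntegrableOn.congr_fun
      ((hw.mul_const (κ 0)).sub (hint.mono_set (Ioi_subset_Ioi hδ.le))) (fun t _ ↦ ?_)
      measurableSet_Ioi
    simp only [Pi.sub_apply]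
    ring
  have htail : ∫ t in Ioi δ, weilArchDensity t * (κ 0 - κ t) =
      (∫ t in Ioi δ, weilArchDensity t) * κ 0 - ∫ t in Ioi δ, weilArchDensity t * κ t := by
    rw [← integral_mul_const, ← integral_sub (hw.mul_const _) hwκ]
    exact setIntegral_congr_fun measurableSet_Ioi fun t _ ↦ by ring
  have hsum : ∑ n ∈ weilPrimeIndex a, (Λ n : ℝ) / Real.sqrt n * (κ 0 - κ (Real.log n)) =
      (∑ n ∈ weilPrimeIndex a, (Λ n : ℝ) / Real.sqrt n) * κ 0 -
        ∑ n ∈ weilPrimeIndex a, (Λ n : ℝ) / Real.sqrt n * κ (Real.log n) := by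
    rw [Finset.sum_mul, ← Finset.sum_sub_distrib]
    exact Finset.sum_congr rfl fun n _ ↦ by ring
  rw [hsplit, htail, hsum] at h
  linear_combination (1 / 2 : ℝ) * h

/-- A real Weil test is Lipschitz at `0`: `|κ(t) − κ(0)| ≤ M₁ t` on `(0, 1]`.  PROVED. -/
theorem exists_forall_abs_sub_apply_zero_le (hκ : IsWeilTest fun t ↦ (κ t : ℂ)) :
    ∃ M₁ : ℝ, ∀ t ∈ Ioc (0 : ℝ) 1, |κ t - κ 0| ≤ M₁ * t := by
  obtain ⟨L, -, hL⟩ := AWS.exists_forall_abs_deriv_le_of_isWeilTest hκ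
  have hd : Differentiable ℝ κ := (AWS.contDiff_of_isWeilTest hκ).differentiable (by simp)
  refine ⟨L, fun t ht ↦ ?_⟩
  have h := Convex.norm_image_sub_le_of_norm_deriv_le (f := κ) (s := Set.univ) (x := 0)
    (y := t) (fun z _ ↦ hd z) (fun z _ ↦ by rw [Real.norm_eq_abs]; exact hL z) convex_univ
    (mem_univ _) (mem_univ _)
  rwa [Real.norm_eq_abs, Real.norm_eq_abs, sub_zero, abs_of_pos ht.1] at h

/-- **`N` minus its cutoff approximation is `O(δ)`.**  For a real Weil test `κ` vanishing on
`[2a, ∞)` with `|κ(t) − κ(0)| ≤ M₁ t` on `(0, 1]`, and `0 < δ ≤ 1`: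
`|N(toMul κ) − [(½(γ + log 2π) + ½ log δ) κ(0) + Σ_{log n<2a} Λ(n) n^{-1/2} κ(log n)
   + ∫_δ^∞ w κ]| ≤ (¾ |κ(0)| + M₁) δ`.  PROVED. -/
theorem abs_ccN_toMul_sub_finitePart_le (hκ : IsWeilTest fun t ↦ (κ t : ℂ)) {a : ℝ}
    (hκa : ∀ t, 2 * a ≤ t → κ t = 0) {δ : ℝ} (hδ : 0 < δ) (hδ1 : δ ≤ 1) {M₁ : ℝ}
    (hM₁ : ∀ t ∈ Ioc (0 : ℝ) 1, |κ t - κ 0| ≤ M₁ * t) :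
    |ccN (toMul κ) -
        (((Real.eulerMascheroniConstant + Real.log (2 * π)) / 2 + Real.log δ / 2) * κ 0 +
          (∑ n ∈ weilPrimeIndex a, (Λ n : ℝ) / Real.sqrt n * κ (Real.log n)) +
          ∫ t in Ioi δ, weilArchDensity t * κ t)| ≤ (3 / 4 * |κ 0| + M₁) * δ := by
  have hM₁nn : 0 ≤ M₁ := by
    have := hM₁ 1 ⟨one_pos, le_rfl⟩
    rw [mul_one] at this
    exact (abs_nonneg _).trans this
  have hA : |∫ t in Ioc (0 : ℝ) δ, weilArchDensity t * (κ 0 - κ t)| ≤ M₁ * δ := by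
    have h := norm_setIntegral_le_of_norm_le_const (μ := volume)
      (f := fun t ↦ weilArchDensity t * (κ 0 - κ t)) (s := Ioc (0 : ℝ) δ) (C := M₁)
      (by simp) fun t ht ↦ by
        have ht1 : t ∈ Ioc (0 : ℝ) 1 := ⟨ht.1, ht.2.trans hδ1⟩
        rw [Real.norm_eq_abs, abs_mul, abs_of_pos (weilArchDensity_pos ht.1), abs_sub_comm]
        calc weilArchDensity t * |κ t - κ 0| ≤ weilArchDensity t * (M₁ * t) :=
            mul_le_mul_of_nonneg_left (hM₁ t ht1) (weilArchDensity_pos ht.1).le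
          _ = M₁ * (t * weilArchDensity t) := by ring
          _ ≤ M₁ * 1 :=
            mul_le_mul_of_nonneg_left (mul_weilArchDensity_le_one ht1.1 ht1.2) hM₁nn
          _ = M₁ := mul_one _
    rw [Real.norm_eq_abs, Real.volume_real_Ioc_of_le hδ.le, sub_zero] at h
    exact h
  have hρ := abs_finitePartRem_le hδ (by linarith)
  have e : ccN (toMul κ) -
      (((Real.eulerMascheroniConstant + Real.log (2 * π)) / 2 + Real.log δ / 2) * κ 0 +
        (∑ n ∈ weilPrimeIndex a, (Λ n : ℝ) / Real.sqrt n * κ (Real.log n)) +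
        ∫ t in Ioi δ, weilArchDensity t * κ t) =
      ((∫ t in Ioc 0 δ, (Real.exp (t / 2) - 1) / (2 * Real.sinh t)) +
          1 / 2 * (Real.log (Real.sinh (δ / 2)) - Real.log (Real.cosh (δ / 2)) -
            Real.log (δ / 2))) * κ 0 -
        ∫ t in Ioc (0 : ℝ) δ, weilArchDensity t * (κ 0 - κ t) := by
    rw [ccN_toMul_eq_cutoff hκ hκa hδ, finitePartCoeff_eq a hδ]
    ring
  rw [e]
  calc _ ≤ |((∫ t in Ioc 0 δ, (Real.exp (t / 2) - 1) / (2 * Real.sinh t)) +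
          1 / 2 * (Real.log (Real.sinh (δ / 2)) - Real.log (Real.cosh (δ / 2)) -
            Real.log (δ / 2))) * κ 0| + |∫ t in Ioc (0 : ℝ) δ, weilArchDensity t * (κ 0 - κ t)| :=
        abs_sub _ _
    _ ≤ 3 / 4 * δ * |κ 0| + M₁ * δ := by
        rw [abs_mul]
        exact add_le_add (mul_le_mul_of_nonneg_right hρ (abs_nonneg _)) hA
    _ = (3 / 4 * |κ 0| + M₁) * δ := by ring

/-! ## 4. The Hadamard finite part of `N` at `u = 1` -/

/-- **The cutoff approximations converge to `N`** (window form).  PROVED. -/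
theorem tendsto_ccN_toMul_cutoff (hκ : IsWeilTest fun t ↦ (κ t : ℂ)) {a : ℝ}
    (hκa : ∀ t, 2 * a ≤ t → κ t = 0) :
    Tendsto (fun δ ↦
        ((Real.eulerMascheroniConstant + Real.log (2 * π)) / 2 + Real.log δ / 2) * κ 0 +
          (∑ n ∈ weilPrimeIndex a, (Λ n : ℝ) / Real.sqrt n * κ (Real.log n)) +
          ∫ t in Ioi δ, weilArchDensity t * κ t) (𝓝[>] 0) (𝓝 (ccN (toMul κ))) := by
  obtain ⟨M₁, hM₁⟩ := exists_forall_abs_sub_apply_zero_le hκ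
  have hb : Tendsto (fun δ : ℝ ↦ (3 / 4 * |κ 0| + M₁) * δ) (𝓝[>] 0) (𝓝 0) := by
    have h : Tendsto (fun δ : ℝ ↦ (3 / 4 * |κ 0| + M₁) * δ) (𝓝 0)
        (𝓝 ((3 / 4 * |κ 0| + M₁) * 0)) := tendsto_id.const_mul _
    rw [mul_zero] at h
    exact tendsto_nhdsWithin_of_tendsto_nhds h
  rw [← tendsto_sub_nhds_zero_iff]
  refine squeeze_zero_norm' ?_ hb
  filter_upwards [Ioc_mem_nhdsGT one_pos] with δ hδ
  rw [Real.norm_eq_abs, abs_sub_comm]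
  exact abs_ccN_toMul_sub_finitePart_le hκ hκa hδ.1 hδ.2 hM₁

/-- The prime part of `N(toMul κ)` for `κ` vanishing on `[2a, ∞)` is the window sum.  PROVED. -/
theorem tsum_vonMangoldt_mul_toMul_eq_sum (κ : ℝ → ℝ) {a : ℝ}
    (hκa : ∀ t, 2 * a ≤ t → κ t = 0) :
    ∑' n : ℕ, Λ n * toMul κ n =
      ∑ n ∈ weilPrimeIndex a, (Λ n : ℝ) / Real.sqrt n * κ (Real.log n) := by
  have hvan : ∀ n ∉ weilPrimeIndex a, (Λ n : ℝ) * toMul κ n = 0 := by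
    intro n hn
    rw [mem_weilPrimeIndex, not_lt] at hn
    rcases Nat.eq_zero_or_pos n with rfl | hn0
    · simp
    · rw [toMul_natCast κ hn0, hκa _ hn, zero_div, mul_zero]
  rw [tsum_eq_sum hvan]
  refine Finset.sum_congr rfl fun n _ ↦ ?_
  rcases Nat.eq_zero_or_pos n with rfl | hn0
  · simp
  · rw [toMul_natCast κ hn0]
    ring

/-- **The Hadamard finite part of `N` at `u = 1` is `½(γ + log 2π)`.**  For every real Weil
test `κ`, as `δ → 0⁺`,
`Σ_n Λ(n) (toMul κ)(n) + ∫_δ^∞ e^{t/2} κ(t) dt/(2 sinh t) + (½ log δ + ½(γ + log 2π)) κ(0)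
  ⟶ N(toMul κ)`.  PROVED. -/
theorem tendsto_ccN_toMul_finitePart (hκ : IsWeilTest fun t ↦ (κ t : ℂ)) :
    Tendsto (fun δ ↦
        ((Real.eulerMascheroniConstant + Real.log (2 * π)) / 2 + Real.log δ / 2) * κ 0 +
          (∑' n : ℕ, Λ n * toMul κ n) + ∫ t in Ioi δ, weilArchDensity t * κ t)
      (𝓝[>] 0) (𝓝 (ccN (toMul κ))) := by
  obtain ⟨R, hR0, hR⟩ := exists_eq_zero_of_lt_abs_of_isWeilTest hκ
  have hκa : ∀ t, 2 * ((R + 1) / 2) ≤ t → κ t = 0 := fun t ht ↦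
    hR t (by rw [abs_of_nonneg (by linarith)]; linarith)
  rw [tsum_vonMangoldt_mul_toMul_eq_sum κ hκa]
  exact tendsto_ccN_toMul_cutoff hκ hκa

/-- **Uniqueness of the finite part**: if `κ(0) ≠ 0`, the only constant `C` for which
`(C + ½ log δ) κ(0) + Σ_n Λ(n)(toMul κ)(n) + ∫_δ^∞ w κ → N(toMul κ)` is `C = ½(γ + log 2π)`.
PROVED. -/
theorem finitePart_unique (hκ : IsWeilTest fun t ↦ (κ t : ℂ)) (hκ0 : κ 0 ≠ 0) {C : ℝ}
    (hC : Tendsto (fun δ ↦ (C + Real.log δ / 2) * κ 0 + (∑' n : ℕ, Λ n * toMul κ n) +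
        ∫ t in Ioi δ, weilArchDensity t * κ t) (𝓝[>] 0) (𝓝 (ccN (toMul κ)))) :
    C = (Real.eulerMascheroniConstant + Real.log (2 * π)) / 2 := by
  set C₀ := (Real.eulerMascheroniConstant + Real.log (2 * π)) / 2 with hC₀
  have h1 : Tendsto (fun δ ↦ (C + Real.log δ / 2) * κ 0 + (∑' n : ℕ, Λ n * toMul κ n) +
      ∫ t in Ioi δ, weilArchDensity t * κ t) (𝓝[>] 0)
      (𝓝 (ccN (toMul κ) + (C - C₀) * κ 0)) :=
    ((tendsto_ccN_toMul_finitePart hκ).add_const ((C - C₀) * κ 0)).congr fun δ ↦ by ring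
  have h2 := tendsto_nhds_unique hC h1
  have h3 : (C - C₀) * κ 0 = 0 := by linarith
  rcases mul_eq_zero.1 h3 with h | h
  · linarith
  · exact absurd h hκ0

/-! ## 5. `N(1) = −∞` literally: bumps shrinking onto the point `u = 1` -/

/-- **Upper bound at the point.**  For a real Weil test with `κ ≤ κ(0)` on `(0, ε]`, `κ = 0` on
`[ε, ∞)`, `0 ≤ κ(0)`, `0 < ε ≤ ½` (no prime lengths in the window):
`N(toMul κ) ≤ (½(γ + log 2π) + ½ log ε + ¾ ε) κ(0)`.  PROVED. -/
theorem ccN_toMul_le_finitePart (hκ : IsWeilTest fun t ↦ (κ t : ℂ)) {ε : ℝ} (hε : 0 < ε)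
    (hε1 : ε ≤ 1 / 2) (hκε : ∀ t, ε ≤ t → κ t = 0) (hle : ∀ t ∈ Ioc (0 : ℝ) ε, κ t ≤ κ 0)
    (h0 : 0 ≤ κ 0) :
    ccN (toMul κ) ≤ ((Real.eulerMascheroniConstant + Real.log (2 * π)) / 2 + Real.log ε / 2 +
      3 / 4 * ε) * κ 0 := by
  have hκa : ∀ t, 2 * (ε / 2) ≤ t → κ t = 0 := fun t ht ↦ hκε t (by linarith)
  have hΛ : ∀ n ∈ weilPrimeIndex (ε / 2), (Λ n : ℝ) = 0 := fun n hn ↦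
    vonMangoldt_eq_zero_of_mem_weilPrimeIndex (by linarith) hn
  have hS1 : ∑ n ∈ weilPrimeIndex (ε / 2), (Λ n : ℝ) / Real.sqrt n * κ (Real.log n) = 0 :=
    Finset.sum_eq_zero fun n hn ↦ by rw [hΛ n hn, zero_div, zero_mul]
  have hI : ∫ t in Ioi ε, weilArchDensity t * κ t = 0 :=
    setIntegral_eq_zero_of_forall_eq_zero fun t ht ↦ by rw [hκε t (le_of_lt ht), mul_zero]
  have hA : 0 ≤ ∫ t in Ioc (0 : ℝ) ε, weilArchDensity t * (κ 0 - κ t) :=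
    setIntegral_nonneg measurableSet_Ioc fun t ht ↦
      mul_nonneg (weilArchDensity_pos ht.1).le (sub_nonneg.2 (hle t ht))
  have hρ := abs_finitePartRem_le hε (by linarith)
  have h1 := mul_le_mul_of_nonneg_right ((le_abs_self _).trans hρ) h0
  rw [ccN_toMul_eq_cutoff hκ hκa hε, finitePartCoeff_eq (ε / 2) hε, hS1, hI]
  nlinarith [h1, hA]

/-- The flat-top bump at `u = 1` of width `ε`: a real Weil test `0 ≤ κ ≤ 1 = κ(0)`, `κ = 1` on
`[−ε/2, ε/2]`, `κ = 0` off `(−ε, ε)`.  PROVED (`ContDiffBump`). -/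
theorem exists_weilTest_flatTop {ε : ℝ} (hε : 0 < ε) :
    ∃ κ : ℝ → ℝ, IsWeilTest (fun t ↦ (κ t : ℂ)) ∧ (∀ t, 0 ≤ κ t ∧ κ t ≤ 1) ∧ κ 0 = 1 ∧
      (∀ t, ε ≤ |t| → κ t = 0) ∧ ∀ t, |t| ≤ ε / 2 → κ t = 1 := by
  let b : ContDiffBump (0 : ℝ) := ⟨ε / 2, ε, half_pos hε, by linarith⟩
  refine ⟨b, ⟨Complex.ofRealCLM.contDiff.comp b.contDiff,
    b.hasCompactSupport.comp_left Complex.ofReal_zero⟩, fun t ↦ ⟨b.nonneg, b.le_one⟩,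
    b.one_of_mem_closedBall (Metric.mem_closedBall_self (half_pos hε).le),
    fun t ht ↦ b.zero_of_le_dist ?_, fun t ht ↦ b.one_of_mem_closedBall ?_⟩
  · show ε ≤ dist t 0
    rwa [Real.dist_eq, sub_zero]
  · rw [Metric.mem_closedBall, Real.dist_eq, sub_zero]
    exact ht

/-- **`N(1) = −∞` at the rate `½ log ε`, finite part included.**  For every `0 < ε ≤ ½` there is
a real Weil test `0 ≤ κ ≤ 1 = κ(0)` supported in `[−ε, ε]` with
`N(toMul κ) ≤ ½ log ε + ½(γ + log 2π) + ¾ ε`.  PROVED. -/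
theorem exists_ccN_toMul_le_half_log {ε : ℝ} (hε : 0 < ε) (hε1 : ε ≤ 1 / 2) :
    ∃ κ : ℝ → ℝ, IsWeilTest (fun t ↦ (κ t : ℂ)) ∧ (∀ t, 0 ≤ κ t ∧ κ t ≤ 1) ∧ κ 0 = 1 ∧
      (∀ t, ε ≤ |t| → κ t = 0) ∧
      ccN (toMul κ) ≤ Real.log ε / 2 + (Real.eulerMascheroniConstant + Real.log (2 * π)) / 2 +
        3 / 4 * ε := by
  obtain ⟨κ, hκ, h01, hκ0, hκε, -⟩ := exists_weilTest_flatTop hε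
  refine ⟨κ, hκ, h01, hκ0, hκε, ?_⟩
  have h := ccN_toMul_le_finitePart hκ hε hε1
    (fun t ht ↦ hκε t (ht.trans (le_abs_self t))) (fun t _ ↦ by rw [hκ0]; exact (h01 t).2)
    (by rw [hκ0]; exact zero_le_one)
  rw [hκ0, mul_one] at h
  linarith

end Summit.RiemannHypothesis.RiemannHypothesis.Theorems.MotivicDoor.ConnesConsani

end
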